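import Literature.AlgebraicGeometry.Morphisms.FormalFunctionsCechProofs
import HarnessLib

/-!
# Formal functions for `H⁰`: levelwise lifting from the graded Čech `H¹` (the Mittag-Leffler step)

Sibling proofs file of `Literature/AlgebraicGeometry/Morphisms/FormalFunctions.lean` (named fact
`Literature.AlgebraicGeometry.Morphisms.formalFunctions_H0`, The Stacks Project, Tag 02OC, case
`p = 0`, `𝓕 = 𝒪_X`) and of `Literature/AlgebraicGeometry/Morphisms/CechH1.lean`. For an arbitrary
ring `A`, ideal `I ⊆ A`, `A`-scheme `f : X → Spec A` and family of opens `𝒰 = (U_i)` of `X` we set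
up, with Mathlib primitives and the Čech complex of `CechH1.lean`, the **graded Čech cohomology of
the powers of the ideal sheaf `𝓘 = I 𝒪_X`** and the **connecting homomorphism**, and we carry out
the Mittag-Leffler argument of Görtz–Wedhorn, *Algebraic Geometry II*, Lemma 24.40 (for `p = 0`)
in this language (namespace `InfinitesimalCech`):

* `vanishing I f n V ⊆ Γ(X, V)` — the functions on `V` vanishing on `V_n = ι_n⁻¹ V ⊆ X_n`
  (`X_n = X ×_A A/I^{n+1}`), i.e. `Γ(V, 𝓘^{n+1})`; on affine `V` this is `I^{n+1} Γ(X, V)`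
  (`mem_map_of_app_ι_eq_zero`), and it is defined for every open, so that no separatedness of
  `X` (affineness of the `U_i ∩ U_j`) is needed below; `I · vanishing n ⊆ vanishing (n+1)`
  (`smul_mem_vanishing_succ`, by locality);
* the sub-complex `C0 n = Π_i Γ(U_i, 𝓘^{n+1})`, `C1 n = Π_{ij} Γ(U_ij, 𝓘^{n+1})` of the Čech
  complex of `𝒪_X`, its cocycles `Z1 n`, coboundaries `B1 n = d⁰(C0 n)` and cohomology
  `H1 n = Ȟ¹(𝒰, 𝓘^{n+1})`, with the maps `ρ n : H1 (n+1) → H1 n` (inclusion `𝓘^{n+2} ⊆ 𝓘^{n+1}`),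
  `μ n a : H1 n → H1 (n+1)` for `a ∈ I` (multiplication — together these are the graded module
  structure of `⊕_n Ȟ¹(𝒰, 𝓘^{n+1})` over the Rees algebra `⊕_k I^k`), `toCechH1 n : H1 n → Ȟ¹(𝒰, 𝒪_X)`,
  and `ρ ∘ μ_a = a • (-)` (`ρ_μ`);
* the connecting map `δ n : Γ(X_n, 𝒪) → H1 n` of `0 → 𝓘^{n+1} → 𝒪_X → 𝒪_{X_n} → 0` for affine `U_i`
  (local lifts `m_i` of `t|_{(U_i)_n}` exist as `ι_n` is a closed immersion; `δ t = [(m_j - m_i)]`,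
  independent of the lifts, `δ_eq_mk`), with `a • δ t = δ (a t)` (`smul_δ`),
  `ρ (δ t') = δ (t'|_{X_n})` (`ρ_δ`), and `δ t = 0 ⇒ t` lifts to `Γ(X, 𝒪_X)`
  (`exists_restrict_eq_of_δ_eq_zero`, gluing corrected lifts);
* `C n ⊆ H1 n`, the `A`-span of the image of `δ n` (the `C_{n+1}` of loc. cit.:
  `coker (Γ(X, 𝒪) → Γ(X_n, 𝒪)) ↪ H¹(X, 𝓘^{n+1})`), killed by `I^{n+1}` (`smul_eq_zero_of_mem_C`).

Main result (`InfinitesimalCech.levelwise_of_gradedStable`): if the `U_i` are affine and cover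
`X` and the graded module `C = ⊕_n C_n` is **eventually standard** —
`C (n+1) ⊆ Σ_{a ∈ I} μ_a (C n)` for `n ≥ n₀`, which is how "`C` is a finitely generated module
over the Rees algebra" is used in loc. cit. — then every compatible family
`(s_n ∈ Γ(X_n, 𝒪))_n` lifts levelwise: each `s_n` is the restriction of a global function on `X`
(the Mittag-Leffler conclusion `im (C_{k} → C_n) = 0` for `k ≫ n`: `ρ^r` maps `C_{n+r}` into
`I^r C_n` for `n ≥ n₀`, and `I^{n+1} C_n = 0`). This is hypothesis (LS) of
`Literature/AlgebraicGeometry/Morphisms/FormalFunctionsProofs.lean`; the finiteness of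
`⊕_n Ȟ¹(𝒰, 𝓘^{n+1})` over the Rees algebra for `A` Noetherian and `f` proper (Görtz–Wedhorn II,
Prop. 24.39 (1), `p = 1`; The Stacks Project, Tag 02O5), from which the eventual standardness
follows, is NOT proved here (Mathlib, pin v4.32, has no coherent cohomology of schemes).

## References

* U. Görtz, T. Wedhorn, *Algebraic Geometry II: Cohomology of Schemes*, Springer Spektrum (2023):
  Lemma 24.40 and the direct proof of Thm. 24.37 in Section (24.7) (PDF pp. 527–529).
* The Stacks Project, Tag 02OC (Cohomology of Schemes, Theorem 30.20.5), Tag 02OB (Lemma 30.20.1)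
  and Tag 01ED (Cohomology, Section 20.9: Čech cohomology).
-/

noncomputable section

open CategoryTheory AlgebraicGeometry Limits TopologicalSpace Opposite

universe u v

namespace Literature.AlgebraicGeometry.Morphisms

namespace InfinitesimalCech

open infinitesimalNeighbourhood

variable {A : Type u} [CommRing A] (I : Ideal A) {X : Scheme.{u}} (f : X ⟶ Spec (.of A))

/-! ### Sections of the powers of the ideal sheaf: functions vanishing on `V_n` -/

/-- `Γ(V, 𝓘^{n+1})`: the functions on the open `V ⊆ X` vanishing on `V_n = ι_n⁻¹ V ⊆ X_n`
(`X_n = X ×_A A/I^{n+1}`), an `A`-submodule of `Γ(X, V)`; for affine `V` it is `I^{n+1} Γ(X, V)`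
(`mem_map_of_app_ι_eq_zero`). [folklore] -/
def vanishing (n : ℕ) (V : X.Opens) : Submodule A (Sections f V) :=
  (RingHom.ker (appι f I n V)).restrictScalars A

/-- Membership in `vanishing`. [folklore] -/
theorem mem_vanishing_iff {n : ℕ} {V : X.Opens} (x : Sections f V) :
    x ∈ vanishing I f n V ↔ appι f I n V x = 0 :=
  Iff.rfl

/-- `vanishing` is stable under restriction. [folklore] -/
theorem res_mem_vanishing {n : ℕ} {V W : X.Opens} (h : W ≤ V) {x : Sections f V}
    (hx : x ∈ vanishing I f n V) : Sections.res f h x ∈ vanishing I f n W := by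
  rw [mem_vanishing_iff] at hx ⊢
  rw [appι_res, hx, map_zero]

/-- `Γ(V, 𝓘^{n+2}) ⊆ Γ(V, 𝓘^{n+1})`: vanishing on `V_{n+1}` implies vanishing on `V_n ⊆ V_{n+1}`.
[folklore] -/
theorem vanishing_succ_le (n : ℕ) (V : X.Opens) : vanishing I f (n + 1) V ≤ vanishing I f n V := by
  intro x hx
  rw [mem_vanishing_iff] at hx ⊢
  have e := Scheme.Hom.congr_app (transition_ι I f n).symm V
  change ((ι I f n).app V).hom x = 0
  rw [e, Scheme.Hom.comp_app]
  change ((infinitesimalNeighbourhood I f n).presheaf.map (eqToHom _).op)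
      (((transition I f n).app _) (appι f I (n + 1) V x)) = 0
  rw [hx, map_zero, map_zero]

/-- `I^{n+1} Γ(X, V) ⊆ Γ(V, 𝓘^{n+1})`. [folklore] -/
theorem smul_mem_vanishing_of_mem_pow {n : ℕ} {V : X.Opens} {a : A} (ha : a ∈ I ^ (n + 1))
    (x : Sections f V) : a • x ∈ vanishing I f n V := by
  rw [mem_vanishing_iff, Algebra.smul_def, map_mul, appι_algebraMap_eq_zero f I n V ha, zero_mul]

/-- Vanishing on `V_k` is local on `V`: it may be checked after restriction to the affine opens
`W ⊆ V` (sheaf condition on `X_k` for the cover `(W_k)_W` of `V_k`). [folklore] -/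
theorem appι_eq_zero_of_forall_affineOpens {k : ℕ} {V : X.Opens} (x : Sections f V)
    (h : ∀ (W : X.affineOpens) (hW : (W : X.Opens) ≤ V), appι f I k W (Sections.res f hW x) = 0) :
    appι f I k V x = 0 := by
  let J := {W : X.affineOpens // (W : X.Opens) ≤ V}
  have hcover : (ι I f k) ⁻¹ᵁ V ≤ ⨆ W : J, (ι I f k) ⁻¹ᵁ ((W : X.affineOpens) : X.Opens) := by
    rw [← Scheme.Hom.preimage_iSup]
    exact (ι I f k).preimage_mono (iSup_affineOpens_le V).ge
  apply (infinitesimalNeighbourhood I f k).sheaf.eq_of_locally_eq'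
    (fun W : J ↦ (ι I f k) ⁻¹ᵁ ((W : X.affineOpens) : X.Opens)) ((ι I f k) ⁻¹ᵁ V)
    (fun W : J ↦ homOfLE ((ι I f k).preimage_mono (U := ((W : X.affineOpens) : X.Opens)) W.2))
    hcover
  intro W
  change (infinitesimalNeighbourhood I f k).presheaf.map (homOfLE ((ι I f k).preimage_mono W.2)).op
      (appι f I k V x) =
    (infinitesimalNeighbourhood I f k).presheaf.map (homOfLE ((ι I f k).preimage_mono W.2)).op 0
  rw [map_zero, ← appι_res f I k W.2 x, h W.1 W.2]

/-- **`I · Γ(V, 𝓘^{n+1}) ⊆ Γ(V, 𝓘^{n+2})`**: locally on an affine `W ⊆ V`, `x|_W ∈ I^{n+1} Γ(X, W)`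
(`mem_map_of_app_ι_eq_zero`), so `(a x)|_W ∈ I^{n+2} Γ(X, W)` dies on `W_{n+1}`. [folklore] -/
theorem smul_mem_vanishing_succ {n : ℕ} {V : X.Opens} {a : A} (ha : a ∈ I) {x : Sections f V}
    (hx : x ∈ vanishing I f n V) : a • x ∈ vanishing I f (n + 1) V := by
  rw [mem_vanishing_iff]
  refine appι_eq_zero_of_forall_affineOpens I f _ fun W hW ↦ ?_
  rw [map_smul]
  have hle : (I ^ (n + 2)).map (algebraMap A (Sections f W)) ≤
      RingHom.ker (appι f I (n + 1) W) :=
    Ideal.map_le_iff_le_comap.mpr fun b hb ↦ RingHom.mem_ker.mpr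
      (appι_algebraMap_eq_zero f I (n + 1) W hb)
  refine RingHom.mem_ker.mp (hle ?_)
  rw [Algebra.smul_def, pow_succ', Ideal.map_mul]
  exact Ideal.mul_mem_mul (Ideal.mem_map_of_mem _ ha)
    (mem_map_of_app_ι_eq_zero f I n W.2 _ ((mem_vanishing_iff I f _).mp
      (res_mem_vanishing I f hW hx)))

/-! ### The graded Čech complex `Č^•(𝒰, 𝓘^{n+1})` in degrees `≤ 1` and its `H¹` -/

variable {ι' : Type v} (U : ι' → X.Opens)

/-- `Č⁰(𝒰, 𝓘^{n+1}) = Π_i Γ(U_i, 𝓘^{n+1}) ⊆ Č⁰(𝒰, 𝒪_X)`. [cite: StacksProject, Tag 01ED (Cohomology, Section 20.9)] -/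
def C0 (n : ℕ) : Submodule A (CechC0 f U) :=
  Submodule.pi Set.univ fun i ↦ vanishing I f n (U i)

/-- `Č¹(𝒰, 𝓘^{n+1}) = Π_{i,j} Γ(U_i ∩ U_j, 𝓘^{n+1}) ⊆ Č¹(𝒰, 𝒪_X)`. [cite: StacksProject, Tag 01ED (Cohomology, Section 20.9)] -/
def C1 (n : ℕ) : Submodule A (CechC1 f U) :=
  Submodule.pi Set.univ fun i ↦ Submodule.pi Set.univ fun j ↦ vanishing I f n (U i ⊓ U j)

/-- Membership in `C0`. [folklore] -/
theorem mem_C0_iff (n : ℕ) (b : CechC0 f U) : b ∈ C0 I f U n ↔ ∀ i, b i ∈ vanishing I f n (U i) := by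
  simp [C0, Submodule.mem_pi]

/-- Membership in `C1`. [folklore] -/
theorem mem_C1_iff (n : ℕ) (c : CechC1 f U) :
    c ∈ C1 I f U n ↔ ∀ i j, c i j ∈ vanishing I f n (U i ⊓ U j) := by
  simp [C1, Submodule.mem_pi]

/-- `d⁰` maps `Č⁰(𝒰, 𝓘^{n+1})` into `Č¹(𝒰, 𝓘^{n+1})`. [folklore] -/
theorem cechD0_mem_C1 {n : ℕ} {b : CechC0 f U} (hb : b ∈ C0 I f U n) :
    cechD0 f U b ∈ C1 I f U n := by
  rw [mem_C0_iff] at hb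
  rw [mem_C1_iff]
  intro i j
  rw [cechD0_apply]
  exact Submodule.sub_mem _ (res_mem_vanishing I f _ (hb j)) (res_mem_vanishing I f _ (hb i))

/-- `C0 (n+1) ⊆ C0 n`. [folklore] -/
theorem C0_succ_le (n : ℕ) : C0 I f U (n + 1) ≤ C0 I f U n := fun b hb ↦
  (mem_C0_iff I f U n b).mpr fun i ↦ vanishing_succ_le I f n _ ((mem_C0_iff I f U _ b).mp hb i)

/-- `C1 (n+1) ⊆ C1 n`. [folklore] -/
theorem C1_succ_le (n : ℕ) : C1 I f U (n + 1) ≤ C1 I f U n := fun c hc ↦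
  (mem_C1_iff I f U n c).mpr fun i j ↦
    vanishing_succ_le I f n _ ((mem_C1_iff I f U _ c).mp hc i j)

/-- `a • C0 n ⊆ C0 (n+1)` for `a ∈ I`. [folklore] -/
theorem smul_mem_C0_succ {n : ℕ} {a : A} (ha : a ∈ I) {b : CechC0 f U} (hb : b ∈ C0 I f U n) :
    a • b ∈ C0 I f U (n + 1) :=
  (mem_C0_iff I f U _ _).mpr fun i ↦ smul_mem_vanishing_succ I f ha ((mem_C0_iff I f U _ b).mp hb i)

/-- `a • C1 n ⊆ C1 (n+1)` for `a ∈ I`. [folklore] -/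
theorem smul_mem_C1_succ {n : ℕ} {a : A} (ha : a ∈ I) {c : CechC1 f U} (hc : c ∈ C1 I f U n) :
    a • c ∈ C1 I f U (n + 1) :=
  (mem_C1_iff I f U _ _).mpr fun i j ↦
    smul_mem_vanishing_succ I f ha ((mem_C1_iff I f U _ c).mp hc i j)

/-- The cocycles `Ž¹(𝒰, 𝓘^{n+1}) = Č¹(𝒰, 𝓘^{n+1}) ∩ ker d¹`. [cite: StacksProject, Tag 01ED (Cohomology, Section 20.9)] -/
def Z1 (n : ℕ) : Submodule A (CechC1 f U) := C1 I f U n ⊓ cechZ1 f U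

/-- The coboundaries `B̌¹(𝒰, 𝓘^{n+1}) = d⁰ (Č⁰(𝒰, 𝓘^{n+1}))`. [cite: StacksProject, Tag 01ED (Cohomology, Section 20.9)] -/
def B1 (n : ℕ) : Submodule A (CechC1 f U) := (C0 I f U n).map (cechD0 f U)

/-- `B̌¹ ⊆ Ž¹`. [folklore] -/
theorem B1_le_Z1 (n : ℕ) : B1 I f U n ≤ Z1 I f U n := by
  rintro _ ⟨b, hb, rfl⟩
  exact ⟨cechD0_mem_C1 I f U hb, cechD1_cechD0 f U b⟩

/-- `Ž¹(𝓘^{n+2}) ⊆ Ž¹(𝓘^{n+1})`. [folklore] -/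
theorem Z1_succ_le (n : ℕ) : Z1 I f U (n + 1) ≤ Z1 I f U n :=
  inf_le_inf_right _ (C1_succ_le I f U n)

/-- `B̌¹(𝓘^{n+2}) ⊆ B̌¹(𝓘^{n+1})`. [folklore] -/
theorem B1_succ_le (n : ℕ) : B1 I f U (n + 1) ≤ B1 I f U n :=
  Submodule.map_mono (C0_succ_le I f U n)

/-- `B̌¹(𝓘^{n+1}) ⊆ B̌¹(𝒪_X)`. [folklore] -/
theorem B1_le_cechB1 (n : ℕ) : B1 I f U n ≤ cechB1 f U := by
  rintro _ ⟨b, -, rfl⟩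
  exact ⟨b, rfl⟩

/-- **The graded Čech cohomology `Ȟ¹(𝒰, 𝓘^{n+1}) = Ž¹ / B̌¹`** of the powers of the ideal sheaf
`𝓘 = I 𝒪_X`, an `A`-module. [cite: StacksProject, Tag 01ED (Cohomology, Section 20.9)] -/
abbrev H1 (n : ℕ) : Type (max u v) :=
  ↥(Z1 I f U n) ⧸ (B1 I f U n).comap (Z1 I f U n).subtype

/-- The class of a cocycle. [folklore] -/
def H1.mk (n : ℕ) : ↥(Z1 I f U n) →ₗ[A] H1 I f U n := Submodule.mkQ _

/-- `H1.mk` is surjective. [folklore] -/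
theorem H1.mk_surjective (n : ℕ) : Function.Surjective (H1.mk I f U n) :=
  Submodule.mkQ_surjective _

/-- Two cocycles have the same class iff they differ by a coboundary. [folklore] -/
theorem H1.mk_eq_mk_iff {n : ℕ} (z z' : Z1 I f U n) :
    H1.mk I f U n z = H1.mk I f U n z' ↔ (z : CechC1 f U) - z' ∈ B1 I f U n := by
  rw [H1.mk, Submodule.mkQ_apply, Submodule.mkQ_apply, Submodule.Quotient.eq, Submodule.mem_comap]
  rfl

/-- A cocycle has class `0` iff it is a coboundary. [folklore] -/
theorem H1.mk_eq_zero_iff {n : ℕ} (z : Z1 I f U n) :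
    H1.mk I f U n z = 0 ↔ (z : CechC1 f U) ∈ B1 I f U n := by
  rw [← map_zero (H1.mk I f U n), H1.mk_eq_mk_iff, ZeroMemClass.coe_zero, sub_zero]

/-- `ρ : Ȟ¹(𝒰, 𝓘^{n+2}) → Ȟ¹(𝒰, 𝓘^{n+1})`, induced by the inclusion `𝓘^{n+2} ⊆ 𝓘^{n+1}`.
[folklore] -/
def ρ (n : ℕ) : H1 I f U (n + 1) →ₗ[A] H1 I f U n :=
  Submodule.mapQ _ _ (Submodule.inclusion (Z1_succ_le I f U n)) fun _ hz ↦ B1_succ_le I f U n hz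

/-- `ρ` on classes. [folklore] -/
theorem ρ_mk (n : ℕ) (z : Z1 I f U (n + 1)) :
    ρ I f U n (H1.mk I f U (n + 1) z) = H1.mk I f U n ⟨z, Z1_succ_le I f U n z.2⟩ :=
  rfl

/-- The comparison `Ȟ¹(𝒰, 𝓘^{n+1}) → Ȟ¹(𝒰, 𝒪_X)` induced by `𝓘^{n+1} ⊆ 𝒪_X`. [folklore] -/
def toCechH1 (n : ℕ) : H1 I f U n →ₗ[A] CechH1 f U :=
  Submodule.mapQ _ _ (Submodule.inclusion (inf_le_right : Z1 I f U n ≤ cechZ1 f U))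
    fun _ hz ↦ B1_le_cechB1 I f U n hz

/-- `toCechH1` on classes. [folklore] -/
theorem toCechH1_mk (n : ℕ) (z : Z1 I f U n) :
    toCechH1 I f U n (H1.mk I f U n z) = CechH1.mk f U ⟨z, z.2.2⟩ :=
  rfl

/-- `μ_a : Ȟ¹(𝒰, 𝓘^{n+1}) → Ȟ¹(𝒰, 𝓘^{n+2})`, multiplication by `a ∈ I` (the degree-one part of the
graded module structure over the Rees algebra `⊕_k I^k`). [folklore] -/
def μ (n : ℕ) (a : A) (ha : a ∈ I) : H1 I f U n →ₗ[A] H1 I f U (n + 1) :=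
  Submodule.mapQ _ _
    ((LinearMap.lsmul A (CechC1 f U) a).restrict (p := Z1 I f U n) (q := Z1 I f U (n + 1))
      fun z hz ↦ ⟨smul_mem_C1_succ I f U ha hz.1, Submodule.smul_mem _ a hz.2⟩)
    (by
      rintro z ⟨b, hb, hbz⟩
      refine ⟨a • b, smul_mem_C0_succ I f U ha hb, ?_⟩
      rw [map_smul, hbz]
      rfl)

/-- `μ_a` on classes. [folklore] -/
theorem μ_mk (n : ℕ) (a : A) (ha : a ∈ I) (z : Z1 I f U n) :
    μ I f U n a ha (H1.mk I f U n z) =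
      H1.mk I f U (n + 1) ⟨a • (z : CechC1 f U),
        ⟨smul_mem_C1_succ I f U ha z.2.1, Submodule.smul_mem _ a z.2.2⟩⟩ :=
  rfl

/-- **`ρ ∘ μ_a = a • (-)`**: multiplying into `𝓘^{n+2}` and coming back is multiplication by `a`
on `Ȟ¹(𝒰, 𝓘^{n+1})`. [folklore] -/
theorem ρ_μ (n : ℕ) (a : A) (ha : a ∈ I) (x : H1 I f U n) : ρ I f U n (μ I f U n a ha x) = a • x := by
  obtain ⟨z, rfl⟩ := H1.mk_surjective I f U n x
  rw [μ_mk, ρ_mk, ← map_smul]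
  exact congrArg _ (Subtype.ext rfl)

/-- `toCechH1 ∘ ρ = toCechH1`. [folklore] -/
theorem toCechH1_ρ (n : ℕ) (x : H1 I f U (n + 1)) :
    toCechH1 I f U n (ρ I f U n x) = toCechH1 I f U (n + 1) x := by
  obtain ⟨z, rfl⟩ := H1.mk_surjective I f U (n + 1) x
  rw [ρ_mk, toCechH1_mk, toCechH1_mk]

/-- `toCechH1 (μ_a x) = a • toCechH1 x`. [folklore] -/
theorem toCechH1_μ (n : ℕ) (a : A) (ha : a ∈ I) (x : H1 I f U n) :
    toCechH1 I f U (n + 1) (μ I f U n a ha x) = a • toCechH1 I f U n x := by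
  obtain ⟨z, rfl⟩ := H1.mk_surjective I f U n x
  rw [μ_mk, toCechH1_mk, toCechH1_mk, ← map_smul]
  exact congrArg _ (Subtype.ext rfl)

/-! ### The connecting homomorphism `δ : Γ(X_n, 𝒪) → Ȟ¹(𝒰, 𝓘^{n+1})` -/

/-- Local lifts of `t ∈ Γ(X_n, 𝒪)`: `m_i ∈ Γ(X, U_i)` with `m_i |_{(U_i)_n} = t |_{(U_i)_n}`.
[folklore] -/
def IsLift (n : ℕ) (t : Γ(infinitesimalNeighbourhood I f n, ⊤)) (m : CechC0 f U) : Prop :=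
  ∀ i, appι f I n (U i) (m i) =
    resTop (infinitesimalNeighbourhood I f n) ((ι I f n) ⁻¹ᵁ (U i)) t

/-- Local lifts exist when the `U_i` are affine (`ι_n : X_n → X` is a closed immersion, Mathlib
`Scheme.Hom.app_surjective`). [folklore] -/
theorem exists_isLift (hU : ∀ i, IsAffineOpen (U i)) (n : ℕ)
    (t : Γ(infinitesimalNeighbourhood I f n, ⊤)) : ∃ m, IsLift I f U n t m := by
  choose m hm using fun i ↦ (ι I f n).app_surjective (U i) (hU i)
    (resTop (infinitesimalNeighbourhood I f n) ((ι I f n) ⁻¹ᵁ (U i)) t)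
  exact ⟨m, hm⟩

/-- For local lifts `m` of `t`, `d⁰ m` is a cocycle of `𝓘^{n+1}`: `m_j - m_i` vanishes on
`(U_i ∩ U_j)_n`. [folklore] -/
theorem cechD0_mem_Z1_of_isLift {n : ℕ} {t : Γ(infinitesimalNeighbourhood I f n, ⊤)}
    {m : CechC0 f U} (hm : IsLift I f U n t m) : cechD0 f U m ∈ Z1 I f U n := by
  refine ⟨(mem_C1_iff I f U n _).mpr fun i j ↦ ?_, cechD1_cechD0 f U m⟩
  rw [mem_vanishing_iff]
  have key : ∀ (k : ι') (h : U i ⊓ U j ≤ U k),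
      appι f I n (U i ⊓ U j) (Sections.res f h (m k)) =
        resTop (infinitesimalNeighbourhood I f n) ((ι I f n) ⁻¹ᵁ (U i ⊓ U j)) t := by
    intro k h
    rw [appι_res, hm k, map_resTop]
  rw [cechD0_apply, map_sub, key j inf_le_right, key i inf_le_left, sub_self]

/-- **The connecting map `δ_n : Γ(X_n, 𝒪) → Ȟ¹(𝒰, 𝓘^{n+1})`** of
`0 → 𝓘^{n+1} → 𝒪_X → 𝒪_{X_n} → 0` (for affine `U_i`): `δ t = [(m_j - m_i)_{ij}]` for local lifts
`m_i` of `t` (a choice; the class is independent of it, `δ_eq_mk`). [cite: GortzWedhorn2023, Lemma 24.40, proof ((24.7.1) for p = 0)] -/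
def δ (hU : ∀ i, IsAffineOpen (U i)) (n : ℕ) (t : Γ(infinitesimalNeighbourhood I f n, ⊤)) :
    H1 I f U n :=
  H1.mk I f U n ⟨cechD0 f U (exists_isLift I f U hU n t).choose,
    cechD0_mem_Z1_of_isLift I f U (exists_isLift I f U hU n t).choose_spec⟩

variable (hU : ∀ i, IsAffineOpen (U i))

/-- `δ t` may be computed with any local lifts: two families of lifts differ by an element of
`Č⁰(𝒰, 𝓘^{n+1})`. [folklore] -/
theorem δ_eq_mk {n : ℕ} {t : Γ(infinitesimalNeighbourhood I f n, ⊤)} {m : CechC0 f U}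
    (hm : IsLift I f U n t m) :
    δ I f U hU n t = H1.mk I f U n ⟨cechD0 f U m, cechD0_mem_Z1_of_isLift I f U hm⟩ := by
  have hm₀ : IsLift I f U n t (exists_isLift I f U hU n t).choose :=
    (exists_isLift I f U hU n t).choose_spec
  rw [δ, H1.mk_eq_mk_iff]
  change cechD0 f U (exists_isLift I f U hU n t).choose - cechD0 f U m ∈ B1 I f U n
  rw [← map_sub]
  refine ⟨_ - m, (mem_C0_iff I f U n _).mpr fun i ↦ ?_, rfl⟩
  rw [mem_vanishing_iff, Pi.sub_apply, map_sub, hm₀ i, hm i, sub_self]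

/-- `δ` is compatible with multiplication by `a ∈ A`: `a • δ t = δ (a t)` (lifts `a m_i`).
[folklore] -/
theorem smul_δ (n : ℕ) (a : A) (t : Γ(infinitesimalNeighbourhood I f n, ⊤)) :
    a • δ I f U hU n t = δ I f U hU n (restrict I f n (algebraMapΓ f a) * t) := by
  obtain ⟨m, hm⟩ := exists_isLift I f U hU n t
  have hm' : IsLift I f U n (restrict I f n (algebraMapΓ f a) * t) (a • m) := fun i ↦ by
    rw [Pi.smul_apply, Algebra.smul_def, map_mul, hm i, map_mul]
    congr 1
    rw [Sections.algebraMap_apply]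
    exact app_resTop (ι I f n) (U i) (algebraMapΓ f a)
  rw [δ_eq_mk I f U hU hm, δ_eq_mk I f U hU hm', ← map_smul]
  congr 1
  exact Subtype.ext (map_smul (cechD0 f U) a m).symm

/-- `δ 0 = 0`. [folklore] -/
theorem δ_zero (n : ℕ) : δ I f U hU n 0 = 0 := by
  have h := smul_δ I f U hU n 0 0
  rwa [zero_smul, mul_zero, eq_comm] at h

/-- `δ` is compatible with the transition maps: `ρ (δ_{n+1} t') = δ_n (t' |_{X_n})` (the same
lifts serve). [folklore] -/
theorem ρ_δ (n : ℕ) (t' : Γ(infinitesimalNeighbourhood I f (n + 1), ⊤)) :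
    ρ I f U n (δ I f U hU (n + 1) t') = δ I f U hU n ((transition I f n).appTop.hom t') := by
  obtain ⟨m, hm⟩ := exists_isLift I f U hU (n + 1) t'
  have hm' : IsLift I f U n ((transition I f n).appTop.hom t') m := fun i ↦ by
    have e := Scheme.Hom.congr_app (transition_ι I f n).symm (U i)
    change ((ι I f n).app (U i)).hom (m i) = _
    rw [e, Scheme.Hom.comp_app]
    change ((infinitesimalNeighbourhood I f n).presheaf.map (eqToHom _).op)
        (((transition I f n).app _) (appι f I (n + 1) (U i) (m i))) = _
    rw [hm i, app_resTop, map_resTop']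
  rw [δ_eq_mk I f U hU hm, δ_eq_mk I f U hU hm', ρ_mk]

/-- **`δ t = 0` implies that `t` lifts to `Γ(X, 𝒪_X)`**: if `(m_j - m_i) = d⁰ b` with
`b_i ∈ Γ(U_i, 𝓘^{n+1})`, the corrected lifts `m_i - b_i` agree on overlaps and glue to a global
function restricting to `t` (checked locally on the `(U_i)_n`). [folklore] -/
theorem exists_restrict_eq_of_δ_eq_zero (hcov : ⨆ i, U i = ⊤) {n : ℕ}
    {t : Γ(infinitesimalNeighbourhood I f n, ⊤)} (h : δ I f U hU n t = 0) :
    ∃ m : Γ(X, ⊤), restrict I f n m = t := by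
  obtain ⟨m, hm⟩ := exists_isLift I f U hU n t
  rw [δ_eq_mk I f U hU hm, H1.mk_eq_zero_iff, B1, Submodule.mem_map] at h
  obtain ⟨b, hb, hbm⟩ := h
  have hbm' : cechD0 f U b = cechD0 f U m := hbm
  rw [mem_C0_iff] at hb
  set m' : CechC0 f U := m - b with hm'def
  have hglue : TopCat.Presheaf.IsCompatible X.presheaf U m' := by
    intro i j
    change Sections.res f inf_le_left (m' i) = Sections.res f inf_le_right (m' j)
    rw [← sub_eq_zero, ← neg_sub]
    have e : Sections.res f inf_le_right (m' j) - Sections.res f inf_le_left (m' i) =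
        cechD0 f U m' i j := rfl
    rw [e, hm'def, map_sub, hbm', sub_self, Pi.zero_apply, Pi.zero_apply, neg_zero]
  obtain ⟨g, hg, -⟩ := X.sheaf.existsUnique_gluing' U ⊤ (fun i ↦ homOfLE le_top) hcov.ge m' hglue
  refine ⟨g, ?_⟩
  apply (infinitesimalNeighbourhood I f n).sheaf.eq_of_locally_eq'
    (fun i ↦ (ι I f n) ⁻¹ᵁ (U i)) ⊤ (fun i ↦ homOfLE le_top)
    (by rw [← Scheme.Hom.preimage_iSup, hcov]; exact le_top)
  intro i
  change resTop _ ((ι I f n) ⁻¹ᵁ (U i)) ((ι I f n).appTop g) =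
    resTop _ ((ι I f n) ⁻¹ᵁ (U i)) t
  have e2 : (resTop X (U i) g : Sections f (U i)) = m' i := hg i
  rw [← app_resTop, ← hm i]
  change appι f I n (U i) (resTop X (U i) g) = _
  rw [e2, hm'def, Pi.sub_apply, map_sub, sub_eq_self]
  exact (mem_vanishing_iff I f _).mp (hb i)

/-! ### The Mittag-Leffler argument -/

/-- **`C_n ⊆ Ȟ¹(𝒰, 𝓘^{n+1})`**: the `A`-span of the image of the connecting map `δ_n` (the module
`C_{n+1} = coker (H⁰(X, 𝒪) → H⁰(X, 𝒪/𝓘^{n+1})) ↪ H¹(X, 𝓘^{n+1})` of Görtz–Wedhorn II,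
Lemma 24.40). [cite: GortzWedhorn2023, Lemma 24.40, proof] -/
def C (n : ℕ) : Submodule A (H1 I f U n) := Submodule.span A (Set.range (δ I f U hU n))

/-- `δ t ∈ C`. [folklore] -/
theorem δ_mem_C (n : ℕ) (t : Γ(infinitesimalNeighbourhood I f n, ⊤)) : δ I f U hU n t ∈ C I f U hU n :=
  Submodule.subset_span ⟨t, rfl⟩

/-- `ρ` maps `C_{n+1}` into `C_n` (`ρ (δ t') = δ (t'|_{X_n})`). [folklore] -/
theorem map_ρ_C_le (n : ℕ) : (C I f U hU (n + 1)).map (ρ I f U n) ≤ C I f U hU n := by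
  rw [Submodule.map_le_iff_le_comap, C, Submodule.span_le]
  rintro _ ⟨t', rfl⟩
  rw [SetLike.mem_coe, Submodule.mem_comap, ρ_δ]
  exact δ_mem_C I f U hU n _

/-- **`I^{n+1} C_n = 0`**: `C_n` is spanned by classes `δ t`, and `a • δ t = δ (a t) = δ 0 = 0` for
`a ∈ I^{n+1}` since `I^{n+1}` kills `Γ(X_n, 𝒪)` ("`C_k` is annihilated by `I^k`", loc. cit.).
[cite: GortzWedhorn2023, Lemma 24.40, proof] -/
theorem smul_eq_zero_of_mem_C {n : ℕ} {a : A} (ha : a ∈ I ^ (n + 1)) {x : H1 I f U n}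
    (hx : x ∈ C I f U hU n) : a • x = 0 := by
  induction hx using Submodule.span_induction with
  | mem x hx =>
    obtain ⟨t, rfl⟩ := hx
    rw [smul_δ, restrict_map_mem_pow I f n ha, zero_mul, δ_zero]
  | zero => exact smul_zero a
  | add x y _ _ hx hy => rw [smul_add, hx, hy, add_zero]
  | smul r x _ hx => rw [smul_comm, hx, smul_zero]

/-- **`μ_a` maps `C_n` into `C_{n+1}`** (so that `C = ⊕_n C_n` is a graded submodule of
`⊕_n Ȟ¹(𝒰, 𝓘^{n+1})` over the Rees algebra): for local lifts `m_i` of `t`, the functions `a m_i`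
agree on the `(U_i ∩ U_j)_{n+1}` (`a (m_j - m_i) ∈ Γ(U_ij, 𝓘^{n+2})`), hence their restrictions glue
to some `t̃ ∈ Γ(X_{n+1}, 𝒪)` with lifts `a m_i`, and `μ_a (δ_n t) = δ_{n+1} t̃`. [cite: GortzWedhorn2023, Lemma 24.40, proof (C is a B-submodule)] -/
theorem map_μ_C_le (hcov : ⨆ i, U i = ⊤) (n : ℕ) (a : A) (ha : a ∈ I) :
    (C I f U hU n).map (μ I f U n a ha) ≤ C I f U hU (n + 1) := by
  rw [C, Submodule.map_span_le]
  rintro _ ⟨t, rfl⟩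
  obtain ⟨m, hm⟩ := exists_isLift I f U hU n t
  have hZ := cechD0_mem_Z1_of_isLift I f U hm
  -- the `a • m_i` are compatible on `X_{n+1}`
  have hcompat : TopCat.Presheaf.IsCompatible (infinitesimalNeighbourhood I f (n + 1)).presheaf
      (fun i ↦ (ι I f (n + 1)) ⁻¹ᵁ (U i)) (fun i ↦ appι f I (n + 1) (U i) (a • m i)) := by
    intro i j
    change (infinitesimalNeighbourhood I f (n + 1)).presheaf.map
        (homOfLE ((ι I f (n + 1)).preimage_mono (inf_le_left : U i ⊓ U j ≤ U i))).op
          (appι f I (n + 1) (U i) (a • m i)) =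
      (infinitesimalNeighbourhood I f (n + 1)).presheaf.map
        (homOfLE ((ι I f (n + 1)).preimage_mono (inf_le_right : U i ⊓ U j ≤ U j))).op
          (appι f I (n + 1) (U j) (a • m j))
    rw [← appι_res f I (n + 1) inf_le_left (a • m i), ← appι_res f I (n + 1) inf_le_right (a • m j),
      ← sub_eq_zero, ← map_sub, map_smul, map_smul, ← smul_sub, ← mem_vanishing_iff, ← neg_sub,
      smul_neg]
    exact Submodule.neg_mem _ (smul_mem_vanishing_succ I f ha ((mem_C1_iff I f U n _).mp hZ.1 i j))
  -- glue them to `t̃ ∈ Γ(X_{n+1}, 𝒪)`, whose lifts are the `a • m_i`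
  obtain ⟨t', ht', -⟩ := (infinitesimalNeighbourhood I f (n + 1)).sheaf.existsUnique_gluing'
    (fun i ↦ (ι I f (n + 1)) ⁻¹ᵁ (U i)) ⊤ (fun i ↦ homOfLE le_top)
    (by rw [← Scheme.Hom.preimage_iSup, hcov]; exact le_top) _ hcompat
  have hm' : IsLift I f U (n + 1) t' (a • m) := fun i ↦ (ht' i).symm
  have key : μ I f U n a ha (δ I f U hU n t) = δ I f U hU (n + 1) t' := by
    rw [δ_eq_mk I f U hU hm, μ_mk, δ_eq_mk I f U hU hm']
    exact congrArg _ (Subtype.ext (map_smul (cechD0 f U) a m).symm)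
  rw [key]
  exact δ_mem_C I f U hU (n + 1) t'

/-- The iterated transition map `ρ^r : Ȟ¹(𝒰, 𝓘^{n+r+1}) → Ȟ¹(𝒰, 𝓘^{n+1})`. [folklore] -/
def ρIter (n : ℕ) : (r : ℕ) → (H1 I f U (n + r) →ₗ[A] H1 I f U n)
  | 0 => LinearMap.id
  | r + 1 => (ρIter n r).comp (ρ I f U (n + r))

/-- `ρ^0 = id`. [folklore] -/
@[simp]
theorem ρIter_zero (n : ℕ) (x : H1 I f U n) : ρIter I f U n 0 x = x := rfl

/-- `ρ^{r+1} = ρ^r ∘ ρ`. [folklore] -/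
theorem ρIter_succ (n r : ℕ) (x : H1 I f U (n + r + 1)) :
    ρIter I f U n (r + 1) x = ρIter I f U n r (ρ I f U (n + r) x) := rfl

/-- `ρ^r (δ_{n+r} s_{n+r}) = δ_n s_n` for a compatible family `(s_n)`. [folklore] -/
theorem ρIter_δ (s : (n : ℕ) → Γ(infinitesimalNeighbourhood I f n, ⊤))
    (hs : ∀ n, (transition I f n).appTop.hom (s (n + 1)) = s n) (n r : ℕ) :
    ρIter I f U n r (δ I f U hU (n + r) (s (n + r))) = δ I f U hU n (s n) := by
  induction r with
  | zero => rfl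
  | succ r ih =>
    show ρIter I f U n r (ρ I f U (n + r) (δ I f U hU (n + r + 1) (s (n + r + 1)))) = _
    rw [ρ_δ, hs (n + r), ih]

/-- **Mittag-Leffler, quantitative form**: if `C_{m+1} ⊆ Σ_{a ∈ I} μ_a C_m` for all `m ≥ n₀`
("`I^r ⊗ C_n → C_{n+r}` is surjective for large `n`", loc. cit.), then for `n ≥ n₀` the iterated
transition map `ρ^r` sends `C_{n+r}` into `I^r C_n` (because `ρ ∘ μ_a = a`).
[cite: GortzWedhorn2023, Lemma 24.40, proof] -/
theorem ρIter_mem_pow_smul {n₀ : ℕ}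
    (hst : ∀ n, n₀ ≤ n → C I f U hU (n + 1) ≤ ⨆ a : I, (C I f U hU n).map (μ I f U n a a.2))
    {n : ℕ} (hn : n₀ ≤ n) :
    ∀ (r : ℕ) (x : H1 I f U (n + r)), x ∈ C I f U hU (n + r) →
      ρIter I f U n r x ∈ I ^ r • C I f U hU n := by
  intro r
  induction r with
  | zero =>
    intro x hx
    rw [pow_zero, Ideal.one_eq_top, Submodule.top_smul]
    exact hx
  | succ r ih =>
    intro x hx
    have hx' := hst (n + r) (by omega) hx
    refine Submodule.iSup_induction (motive := fun y ↦ ρIter I f U n (r + 1) y ∈ I ^ (r + 1) • _)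
      _ hx' ?_ ?_ ?_
    · rintro ⟨a, ha⟩ y ⟨y', hy', rfl⟩
      rw [ρIter_succ, ρ_μ, map_smul, pow_succ', Submodule.mul_smul]
      exact Submodule.smul_mem_smul ha (ih y' hy')
    · rw [map_zero]
      exact Submodule.zero_mem _
    · intro y z hy hz
      rw [map_add]
      exact Submodule.add_mem _ hy hz

/-- Hence `ρ^{n+1}` kills `C_{2n+1}` for `n ≥ n₀` (`I^{n+1} C_n = 0`): the image of `C_k` in `C_n`
vanishes for `k ≫ n`. [cite: GortzWedhorn2023, Lemma 24.40] -/
theorem ρIter_eq_zero {n₀ : ℕ}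
    (hst : ∀ n, n₀ ≤ n → C I f U hU (n + 1) ≤ ⨆ a : I, (C I f U hU n).map (μ I f U n a a.2))
    {n : ℕ} (hn : n₀ ≤ n) (x : H1 I f U (n + (n + 1))) (hx : x ∈ C I f U hU (n + (n + 1))) :
    ρIter I f U n (n + 1) x = 0 := by
  have h := ρIter_mem_pow_smul I f U hU hst hn (n + 1) x hx
  have hle : I ^ (n + 1) • C I f U hU n ≤ ⊥ := Submodule.smul_le.mpr fun a ha y hy ↦ by
    rw [smul_eq_zero_of_mem_C I f U hU ha hy]
    exact Submodule.zero_mem _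
  exact (Submodule.mem_bot A).mp (hle h)

/-- **Levelwise lifting from eventual standardness of `C = ⊕_n C_n`** (Görtz–Wedhorn II,
Lemma 24.40 and the first half of the direct proof of Thm. 24.37, for `p = 0`, `𝓕 = 𝒪_X`): let
`𝒰 = (U_i)` be an affine open cover of the `A`-scheme `X` and suppose that for `n ≥ n₀`,
`C_{n+1} ⊆ Σ_{a ∈ I} μ_a C_n` in `Ȟ¹(𝒰, 𝓘^{n+2})` (as holds when `⊕_n Ȟ¹(𝒰, 𝓘^{n+1})` is a finitely
generated module over the Noetherian Rees algebra `⊕_k I^k`). Then every family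
`(s_n ∈ Γ(X_n, 𝒪))_n` compatible under the transition maps lifts levelwise: each `s_n` is the
restriction of a global function on `X`. (`δ_n s_n = ρ^{k-n} δ_k s_k = 0` for `k ≫ n`, and
`δ_n s_n = 0` means `s_n` lifts.) This is hypothesis (LS) of
`Literature.AlgebraicGeometry.Morphisms.formalFunctions_of_levelwise_of_stable`.
[cite: GortzWedhorn2023, Lemma 24.40 and Thm. 24.37, direct proof in Section (24.7) (PDF pp. 527–529)] -/
theorem levelwise_of_gradedStable (hcov : ⨆ i, U i = ⊤) {n₀ : ℕ}
    (hst : ∀ n, n₀ ≤ n → C I f U hU (n + 1) ≤ ⨆ a : I, (C I f U hU n).map (μ I f U n a a.2))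
    (s : (n : ℕ) → Γ(infinitesimalNeighbourhood I f n, ⊤))
    (hs : ∀ n, (transition I f n).appTop.hom (s (n + 1)) = s n) (n : ℕ) :
    ∃ m : Γ(X, ⊤), restrict I f n m = s n := by
  apply exists_restrict_eq_of_δ_eq_zero I f U hU hcov
  have h1 : δ I f U hU (n + n₀) (s (n + n₀)) = 0 := by
    rw [← ρIter_δ I f U hU s hs (n + n₀) (n + n₀ + 1)]
    exact ρIter_eq_zero I f U hU hst (by omega) _ (δ_mem_C I f U hU _ _)
  rw [← ρIter_δ I f U hU s hs n n₀, h1, map_zero]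

end InfinitesimalCech

end Literature.AlgebraicGeometry.Morphisms

end
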